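import Summits.MatrixMultiplication.OmegaCensus.SmallFormats.MatMul227GF3EnumMarginal
import Summits.MatrixMultiplication.OmegaCensus.SmallFormats.MatMul227GF3EnumWLOG
import Summits.MatrixMultiplication.OmegaCensus.SmallFormats.MatMul227GF3EnumRuns1
import Summits.MatrixMultiplication.OmegaCensus.SmallFormats.MatMul227GF3EnumRuns2
import Summits.MatrixMultiplication.OmegaCensus.SmallFormats.MatMul227GF3EnumRuns3
import Summits.MatrixMultiplication.OmegaCensus.SmallFormats.MatMul227GF3EnumRuns4
import Summits.MatrixMultiplication.OmegaCensus.SmallFormats.MatMul22nGF3MarginalCensus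
import Mathlib.Logic.Equiv.Fintype
import HarnessLib

/-!
# ω-census family (a): kernel `(henum)` at `(7,23)` — orbits, representatives, the theorems

Cell `pub-omega` (unit `pub-omega-tensor`, gen 31), topic `Summits/MatrixMultiplication/OmegaCensus`
(sub-folder `SmallFormats`). Framing (verbatim): lottery ticket; floor = certified bounds/negative ranges.
HONEST FRAMING: bookkeeping — part 12 of 12 of the KERNEL proof of the ENUMERATION hypothesis `(henum)` of
`twentyfour_le_tensorRank_227_gf3_of_enumeration` (`MatMul22nGF3MarginalCensus`) for the six-orbit list of the
`𝔽₃` `⟨2,2,7⟩@23` X-marginal census (desk-certified ×3 before: ENUM-X2 §6/§8). The EXCLUSION hypothesis `(hexcl)`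
stays engine-side (Pa17: two code-disjoint exact engines; the IP instrument); nothing here is a bound on `ω`, and no
sentence here is 'R_𝔽₃(⟨2,2,7⟩) ≥ 24'.

Equal count vectors ⇒ `InOrbit` (a class-matching permutation via `Equiv.ofFiberEquiv`, and signs); words ⇒ orbit
moves (`InOrbit.trans`) acting on count vectors through the generator tables; the three representatives `REP j`; and
the THEOREMS: `henum_227_gf3` (the enumeration hypothesis at `(7,23)` holds for `Reps723 = {REP 0, REP 1, REP 2}`),
`twentyfour_le_tensorRank_227_gf3_of_exclusion` and `tensorRank_227_gf3_mem_of_exclusion` (`R_𝔽₃(⟨2,2,7⟩) ∈ [24, 25]`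
conditional ONLY on the exclusion of the three explicit representatives — engine-side, Pa17).
-/

namespace Summit.MatrixMultiplication.OmegaCensus.SmallFormats.Enum723

open Summit.MatrixMultiplication.OmegaCensus.RankOnePlaneCapGeneral
open Literature.Computability.AlgebraicComplexity Matrix
set_option maxRecDepth 4000

open Finset

/-! ### Equal count vectors ⇒ same orbit (re-indexing and signs) -/

/-- **Marginals with the same count vector lie in one orbit** (data: a permutation matching the classes and a
sign per term; `P = Q = 1`, no transpose). -/
theorem inOrbit_of_cnt_eq {r : ℕ} (m₁ m₂ : Fin r → Matrix (Fin 2) (Fin 2) (ZMod 3)) (h₁ : ∀ i, m₁ i ≠ 0)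
    (h₂ : ∀ i, m₂ i ≠ 0) (h : Eq40 (cnt m₁) (cnt m₂)) : InOrbit m₁ m₂ := by
  classical
  -- fibers of the class maps have equal cardinalities
  let f : Fin r → ℕ := fun i => classOf (mflat (m₂ i))
  let g : Fin r → ℕ := fun i => classOf (mflat (m₁ i))
  have hfib : ∀ a, Fintype.card {i // f i = a} = Fintype.card {i // g i = a} := by
    intro a
    rw [Fintype.card_subtype, Fintype.card_subtype]
    by_cases ha : a < 40
    · show (Finset.univ.filter fun i => classOf (mflat (m₂ i)) = a).card =
        (Finset.univ.filter fun i => classOf (mflat (m₁ i)) = a).card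
      rw [filter_classOf_eq m₂ h₂ a ha, filter_classOf_eq m₁ h₁ a ha]
      exact (h a ha).symm
    · have e1 : (Finset.univ.filter fun i => f i = a) = ∅ :=
        Finset.filter_eq_empty_iff.mpr fun i _ hi => ha (hi ▸ classOf_lt m₂ h₂ i)
      have e2 : (Finset.univ.filter fun i => g i = a) = ∅ :=
        Finset.filter_eq_empty_iff.mpr fun i _ hi => ha (hi ▸ classOf_lt m₁ h₁ i)
      rw [e1, e2]
  let σ : Fin r ≃ Fin r := Equiv.ofFiberEquiv (f := f) (g := g) fun a => Fintype.equivOfCardEq (hfib a)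
  have hσ : ∀ i, classOf (mflat (m₁ (σ i))) = classOf (mflat (m₂ i)) := fun i =>
    Equiv.ofFiberEquiv_map (fun a => Fintype.equivOfCardEq (hfib a)) i
  -- signs
  have hsign : ∀ i, ∃ c : ZMod 3, c ≠ 0 ∧ m₂ i = c • m₁ (σ i) := by
    intro i
    have ha := classOf_lt m₂ h₂ i
    have hV : IsCls (mflat (m₂ i)) (classOf (mflat (m₂ i))) := (classOf_spec _ (isZero43_mflat (h₂ i))).2
    have hU : IsCls (mflat (m₁ (σ i))) (classOf (mflat (m₂ i))) := by
      rw [← hσ i]; exact (classOf_spec _ (isZero43_mflat (h₁ _))).2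
    exact exists_smul_of_isCls ha hU hV
  choose c hc hc' using hsign
  refine ⟨1, 1, false, σ, c, by simp, by simp, hc, fun i => ?_⟩
  rw [transposeIf_false, Matrix.one_mul, Matrix.mul_one]
  exact hc' i

/-! ### Words are orbit moves, and act on count vectors through the generator tables -/

/-- One move stays in the orbit. -/
theorem inOrbit_moveM {r : ℕ} (s : ℕ) (hs : s < 5) (m : Fin r → Matrix (Fin 2) (Fin 2) (ZMod 3)) :
    InOrbit m fun i => moveM s (m i) := by
  by_cases h4 : s = 4
  · subst h4
    simpa [moveM] using inOrbit_transpose m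
  · refine ⟨genM s, 1, false, Equiv.refl _, fun _ => 1, genM_det s (by omega), by simp, fun _ => one_ne_zero,
      fun i => ?_⟩
    simp [moveM, h4]

/-- A word stays in the orbit. -/
theorem inOrbit_moveW {r : ℕ} : ∀ (w : List ℕ), WordOK w → ∀ m : Fin r → Matrix (Fin 2) (Fin 2) (ZMod 3),
    InOrbit m (moveW w m)
  | [], _, m => inOrbit_refl m
  | s :: w, hw, m =>
      (inOrbit_moveM s (hw s (by simp)) m).trans (inOrbit_moveW w (fun t ht => hw t (by simp [ht])) _)

/-- Moves keep marginals nowhere-zero. -/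
theorem moveW_ne_zero {r : ℕ} : ∀ (w : List ℕ), WordOK w → ∀ m : Fin r → Matrix (Fin 2) (Fin 2) (ZMod 3),
    (∀ i, m i ≠ 0) → ∀ i, moveW w m i ≠ 0
  | [], _, m, hm => hm
  | s :: w, hw, m, hm => by
      refine moveW_ne_zero w (fun t ht => hw t (by simp [ht])) _ (fun i h0 => ?_)
      have h1 := move_nonzero (mflat (m i)) s (hw s (by simp)) (isZero43_mflat (hm i))
      rw [← mflat_moveM, h0] at h1
      exact absurd h1 (by decide)

/-- One move acts on the count vector as the generator does. -/
theorem cnt_moveM {r : ℕ} (s : ℕ) (hs : s < 5) (m : Fin r → Matrix (Fin 2) (Fin 2) (ZMod 3)) :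
    Eq40 (cnt fun i => moveM s (m i)) (actS s (cnt m)) := by
  classical
  intro b hb
  simp only [cnt, actS]
  congr 1; ext i
  simp only [Finset.mem_filter, Finset.mem_univ, true_and]
  rw [mflat_moveM]
  exact move_cls _ s hs b hb

/-- A word acts on the count vector as the word does. -/
theorem cnt_moveW {r : ℕ} : ∀ (w : List ℕ), WordOK w → ∀ m : Fin r → Matrix (Fin 2) (Fin 2) (ZMod 3),
    Eq40 (cnt (moveW w m)) (actWS w (cnt m))
  | [], _, m => fun _ _ => rfl
  | s :: w, hw, m => by
      have hs : s < 5 := hw s (by simp)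
      have hw' : WordOK w := fun t ht => hw t (by simp [ht])
      intro b hb
      rw [moveW, actWS, cnt_moveW w hw' _ b hb]
      exact actWS_congr w hw' (cnt_moveM s hs m) b hb

/-! ## The representatives and the enumeration theorem -/

/-- **The three representative marginals** of the six-orbit list at `(n, r) = (7, 23)` (orbits 0, 1, 2; the other
three are their transposes): term `i` ↦ the class matrix of entry `i` of `repClsL j`. -/
def REP (j : ℕ) : Fin 23 → Matrix (Fin 2) (Fin 2) (ZMod 3) := fun i => clsM ((repClsL.getD j []).getD i 0)

/-- The representative class lists list classes. -/
theorem repClsL_lt : ∀ j, j < 3 → ∀ i, i < 23 → (repClsL.getD j []).getD i 0 < 40 := by decide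

/-- The representatives have the tabulated count vectors. -/
theorem cnt_REP : ∀ j, j < 3 → ∀ b, b < 40 →
    (Finset.univ.filter fun i : Fin 23 => IsCls (clsF ((repClsL.getD j []).getD i 0)) b).card =
      (repcL.getD j []).getD b 0 := by
  decide +kernel

/-- The representatives are nowhere zero and have the tabulated count vectors. -/
theorem REP_facts : ∀ j, j < 3 → (∀ i, REP j i ≠ 0) ∧ Eq40 (cnt (REP j)) (repv j) := by
  intro j hj
  refine ⟨fun i h0 => ?_, fun b hb => ?_⟩
  · have h1 := isCls_nonzero (clsF _) _ (repClsL_lt j hj i i.isLt) (Or.inl rfl)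
    rw [← mflat_clsM, show clsM ((repClsL.getD j []).getD (↑i) 0) = REP j i from rfl, h0] at h1
    exact absurd h1 (by decide)
  · rw [repv, ← cnt_REP j hj b hb, cnt]
    rfl

/-- The set of the three representatives. -/
def Reps723 : Set (Fin 23 → Matrix (Fin 2) (Fin 2) (ZMod 3)) := {m | ∃ j, j < 3 ∧ m = REP j}

/-- **The ENUMERATION hypothesis at `(7, 23)` is a theorem** (given the kernel searches): every nowhere-zero
`m : Fin 23 → 𝔽₃^{2×2}` in the universe `XCaps3 7 23` is `InOrbit`-related to one of the three representatives. -/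
theorem henum_of_runs (hI : runCase lo_I hi_I certs_I = true) (hK : KappaRuns)
    (hG : runCase lo_gamma hi_gamma certs_gamma = true) (hT : runCase lo_tau hi_tau certs_tau = true)
    (m : Fin 23 → Matrix (Fin 2) (Fin 2) (ZMod 3)) (hm : ∀ i, m i ≠ 0) (hX : XCaps3 7 23 m) :
    ∃ rep ∈ Reps723, InOrbit m rep := by
  obtain ⟨j, hj, w, hw, he⟩ := enum_of_runs hI hK hG hT (cnt m) (adm_cnt m hm hX)
  obtain ⟨hR0, hRc⟩ := REP_facts j hj
  refine ⟨REP j, ⟨j, hj, rfl⟩, ?_⟩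
  -- the moved representative has the same count vector as `m`
  have hM0 := moveW_ne_zero w hw (REP j) hR0
  have hcnt : Eq40 (cnt (moveW w (REP j))) (cnt m) := fun b hb => by
    rw [cnt_moveW w hw (REP j) b hb, actWS_congr w hw hRc b hb, ← he b hb]
  exact ((inOrbit_moveW w hw (REP j)).trans (inOrbit_of_cnt_eq _ _ hM0 hm hcnt)).symm

/-- **KERNEL `(henum)` at `(7,23)`.** Every nowhere-zero `m : Fin 23 → 𝔽₃^{2×2}` satisfying the X-cap system
`XCaps3 7 23` is `InOrbit`-related (re-indexing, signs, sandwich `P · Q`, optional transpose) to one of the three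
representatives `REP 0, REP 1, REP 2` (orbits 0, 1, 2 of the six-orbit list `margorbits_F3_227_r23.jsonl`; orbits
3, 4, 5 are their transposes). Proof: the kernel searches `run_I`, `run_kappaXY`, `run_gamma`, `run_tau`. -/
theorem henum_227_gf3 (m : Fin 23 → Matrix (Fin 2) (Fin 2) (ZMod 3)) (hm : ∀ i, m i ≠ 0) (hX : XCaps3 7 23 m) :
    ∃ rep ∈ Reps723, InOrbit m rep :=
  henum_of_runs run_I ⟨run_kappa00, run_kappa01, run_kappa10, run_kappa11⟩ run_gamma run_tau m hm hX

/-- **The `⟨2,2,7⟩@23` cell with the enumeration hypothesis DISCHARGED.** IF none of the three explicit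
representatives
* `REP 0` = !![1,1;1,2], !![1,2;2,0], !![1,2;1,1], !![1,0;2,1], !![1,2;2,2], !![1,0;1,2], !![1,1;2,1], !![1,2;1,0], !![1,0;0,0], !![0,1;0,0], !![0,1;0,0], !![1,1;0,0], !![0,0;1,0], !![0,0;0,1], !![0,0;0,1], !![0,0;1,1], !![1,0;1,0], !![1,1;1,1], !![1,2;1,2], !![1,2;1,2], !![1,0;2,0], !![1,1;2,2], !![1,2;2,1]
* `REP 1` = !![1,1;1,2], !![1,2;2,0], !![1,2;1,1], !![1,0;2,1], !![1,2;2,2], !![1,0;1,2], !![1,1;2,1], !![1,2;1,0], !![1,0;0,0], !![0,1;0,0], !![0,1;0,0], !![1,1;0,0], !![0,0;1,0], !![0,0;0,1], !![0,0;0,1], !![0,0;1,1], !![1,0;1,0], !![1,1;1,1], !![1,2;1,2], !![1,2;1,2], !![1,0;2,0], !![1,2;2,1], !![1,2;2,1]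
* `REP 2` = !![1,1;1,2], !![1,2;1,1], !![1,1;2,0], !![1,2;2,2], !![1,1;1,0], !![1,0;2,2], !![1,1;2,1], !![1,0;0,0], !![0,1;0,0], !![0,1;0,0], !![1,2;0,0], !![0,0;1,0], !![0,0;0,1], !![0,0;0,1], !![0,0;1,2], !![1,0;1,0], !![1,1;1,1], !![1,1;1,1], !![1,2;1,2], !![1,0;2,0], !![1,1;2,2], !![1,1;2,2], !![1,2;2,1]
(terms listed as `!![u₀₀,u₀₁;u₁₀,u₁₁]`, i.e. `REP j i = clsM (repClsL[j][i])`) is the X-marginal of a 23-product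
`𝔽₃`-computation of `⟨2,2,7⟩` — the EXCLUSION hypothesis, engine-side (Pa17: two code-disjoint exact engines;
the search-free IP instrument), NOT proved here — THEN `24 ≤ R_𝔽₃(⟨2,2,7⟩)`, one above the printed floor `23`. -/
theorem twentyfour_le_tensorRank_227_gf3_of_exclusion
    (hexcl : ∀ j, j < 3 → ∀ β : BilinComp (mulBilin (ZMod 3) 2 2 7) (Fin 23), xMarginal β ≠ REP j) :
    24 ≤ tensorRank (matMulTensor (ZMod 3) 2 2 7) :=
  twentyfour_le_tensorRank_227_gf3_of_enumeration Reps723 henum_227_gf3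
    (by rintro rep ⟨j, hj, rfl⟩ β; exact hexcl j hj β)

/-- **`R_𝔽₃(⟨2,2,7⟩) ∈ [24, 25]` conditional only on the exclusion of the three representatives** (ceiling:
Hopcroft–Kerr). NOT proved unconditionally here. -/
theorem tensorRank_227_gf3_mem_of_exclusion
    (hexcl : ∀ j, j < 3 → ∀ β : BilinComp (mulBilin (ZMod 3) 2 2 7) (Fin 23), xMarginal β ≠ REP j) :
    tensorRank (matMulTensor (ZMod 3) 2 2 7) ∈ Set.Icc 24 25 :=
  ⟨twentyfour_le_tensorRank_227_gf3_of_exclusion hexcl, hopcroftKerr1971_tensorRank_matMulTensor_22n_le (K := ZMod 3) 7⟩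

end Summit.MatrixMultiplication.OmegaCensus.SmallFormats.Enum723
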